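import Literature.NumberTheory.Automorphic.HyperspecialUnitarySatakeClassicalSymmetry
import Literature.NumberTheory.Automorphic.UnitaryRankOneSatakeIntegral
import HarnessLib

/-!
# The `w₀`-symmetry of the Satake transforms of `U(σ, J₀)` over ANY commutative ring with `q_F = √q` a unit, for
# every `N`, and the counting duality with `q` explicit: `#{a(γ) = μ}·q_F^{(-⟨2ρ,μ⟩)⁺} = #{a(γ) = -μ}·q_F^{⟨2ρ,μ⟩⁺}`
# (Cartier §IV (4.2), Thm. 4.1; Laumon (4.1.4)–(4.1.6); Mínguez §4; Macdonald V (2.6)–(2.7))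

Topic `NumberTheory/Automorphic`; namespace `Literature.NumberTheory.Automorphic.HermitianLattice[.UnramifiedLocalConjDatum]`
(lane `lit-hodgefound`, Track 2 foundations; seat `lit-hodgefound-p11`, generation 47, row g47-#4).  THEOREMS ONLY: no
definition, no named fact, no instance, no notation.  Companion of `HyperspecialUnitarySatakeClassicalSymmetry` (g47-#3:
`𝒮(T)_{-μ} = 𝒮(T)_μ` over `ℂ` with the weights `(√q)^{-⟨ν,·⟩}`, every `N`) in the spirit of `UnitaryRankOneSatakeIntegral`
(g46-#4: the same over an arbitrary commutative ring `R` for `N = 2, 3`): the indices of g47-#2 are powers of the INTEGER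
`q_F = √q = Nat.sqrt #𝓀[K]` (`q = #𝓀[K]` is a square when `σ ≠ id`, g46-#1), so everything holds over any `R` in which
`q_F` is a unit — the form in which unramified Hecke algebras of unitary groups are used with `ℤ[1/q]`-, `ℤ_ℓ`- or
`𝔽̄_ℓ`-coefficients — and the counting duality of g44-#3 holds in `ℕ` with `q` explicit.

## The mathematics

`hd : UnramifiedLocalConjDatum σ ϖ`, `σ ≠ id`, `q = #𝓀[K] = q_F²` finite, `G = U(σ, J₀)`, `K₀`, `K_P = N(𝒪)`,
`t_μ = diag(ϖ^μ)` (`μ ∘ rev = -μ`), `⟨ν, μ⟩ = ∑_i (N-1-i) μ_i` (`satakeTwistExp`), `⟨2ρ, μ⟩ := ∑_{i<j} (μ_i - μ_j) = 2⟨ν, μ⟩`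
on `Λ⁻` (g47-#3 `sum_filter_lt_sub_eq_two_mul_satakeTwistExp`).

* (§1) In `ℕ`: `[K_P : K_P ∩ t_μK_Pt_μ⁻¹] = q_F^{e(μ)}` and `[t_μK_Pt_μ⁻¹ : K_P ∩ t_μK_Pt_μ⁻¹] = q_F^{e'(μ)}` with
  `e(μ) = 2∑_{i<j,i<j'}(μ_i-μ_j)⁺ + ∑_{i<i'}(μ_i-μ_{i'})⁺`, `e'(μ) = e(-μ)`, `e(μ) - e'(μ) = 2⟨ν, μ⟩` (g47-#2, g47-#3).
* (§2) **COUNTING DUALITY WITH `q` EXPLICIT**, for every `N`, every `g ∈ G` and every antisymmetric `μ`: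
  `#{γ ∈ K₀gK₀/K₀ : a(γ) = μ} · q_F^{(-2⟨ν,μ⟩)⁺} = #{γ ∈ K₀gK₀/K₀ : a(γ) = -μ} · q_F^{(2⟨ν,μ⟩)⁺}` (g44-#3's
  `#{μ}·[t_μK_Pt_μ⁻¹ : ∩] = #{-μ}·[K_P : ∩]` with both indices evaluated and the common power `q_F^{min(e,e')}` cancelled)
  — Macdonald's symmetry of the coefficients of the spherical functions up to `δ`.
* (§3) **`𝒮_w(T)_{-μ} = 𝒮_w(T)_μ` OVER ANY COMMUTATIVE RING `R`** for every `N`, every `T ∈ ℋ(U(σ, J₀), K₀; R)` and every `μ`,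
  for any weight `w : Multiplicative ℤ^N →* R` with `w(e) = u^{-⟨ν, e⟩}`, `u ∈ Rˣ`, `(u : R) = q_F` (such `w` exist,
  `exists_weight_units_zpow_neg_satakeTwistExp`): in g44-#3's duality `𝒮_μ · u^{⟨ν,μ⟩} · u^{e'(μ)} = 𝒮_{-μ} · u^{-⟨ν,μ⟩} · u^{e(μ)}`
  the unit factors agree (`⟨ν,μ⟩ + e'(μ) = -⟨ν,μ⟩ + e(μ)`) and cancel.  For `N = 3`, `u^{-⟨ν,μ⟩} = q_F^{-2μ₀} = q^{-μ₀}` is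
  g46-#4's weight (there with the unit `q`).

## What is formalised (theorems only)

* §1 `relIndex_conjAct_borelInt_eq_sqrt_pow_unitary`, `relIndex_borelInt_conjAct_eq_sqrt_pow_unitary` (indices as powers of
  `q_F = Nat.sqrt q` in `ℕ`), `sqrt_card_residueField_pos`.
* §2 **`card_filter_iwasawaExp_mul_sqrt_pow_eq_unitary`** (the counting duality with `q` explicit, every `N`).
* §3 `exists_weight_units_zpow_neg_satakeTwistExp`, **`coeff_satakeTransform_neg_of_units_unitary`**,
  `domCongr_neg_satakeTransform_of_units_unitary`, `satakeTransform_mem_setOf_of_units_unitary`.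

## References
* [CartierCorvallis1979] P. Cartier, *Representations of 𝔭-adic groups: a survey*, PSPM 33.1 (1979), §IV (4.2), Thm. 4.1.
* [Laumon1995] G. Laumon, *Cohomology of Drinfeld Modular Varieties I*, CUP (1996), (4.1.4)–(4.1.6).
* [Minguez2011] A. Mínguez, *Unramified representations of unitary groups*, in: *On the stabilization of the trace
  formula* (2011), §4.
* [Macdonald1995] I. G. Macdonald, *Symmetric Functions and Hall Polynomials*, 2nd ed. (1995), Ch. V (2.6)–(2.7), (3.4).
* [Rogawski1990] J. D. Rogawski, *Automorphic Representations of Unitary Groups in Three Variables*, Ann. of Math. Stud.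
  123 (1990), §4.5 p. 50.
* [Satake1963] I. Satake, Publ. Math. IHÉS 18 (1963), §§6–7.
-/

noncomputable section

open scoped Valued WithZero Matrix MatrixGroups Pointwise
open MonoidAlgebra Representation Finset MulAction ConjAct

namespace Literature.NumberTheory.Automorphic.HermitianLattice

open Literature.NumberTheory.Automorphic.CartanUnique Literature.NumberTheory.Automorphic.SymplecticCartan
  Literature.NumberTheory.Automorphic

variable {K : Type*} [Field K] [Valued K ℤᵐ⁰] {σ : K →+* K} {ϖ : K} {N : ℕ}

namespace UnramifiedLocalConjDatum

/-! ## §1 The indices as powers of `q_F = √q` in `ℕ` -/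

/-- `q_F = √q > 0` (`q_F · q_F = q = #𝓀[K] ≥ 1`). [cite: CartierCorvallis1979, §IV (4.2)] -/
theorem sqrt_card_residueField_pos (hd : UnramifiedLocalConjDatum σ ϖ) (hσ : ∃ x : K, σ x ≠ x) [Finite 𝓀[K]] :
    0 < Nat.sqrt (Nat.card 𝓀[K]) := by
  have h := hd.sqrt_card_residueField_mul_self hσ
  have hq : 0 < Nat.card 𝓀[K] := Nat.card_pos
  rcases Nat.eq_zero_or_pos (Nat.sqrt (Nat.card 𝓀[K])) with h0 | h0
  · rw [h0, mul_zero] at h; omega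
  · exact h0

/-- **`[K_P : K_P ∩ t_μK_Pt_μ⁻¹] = q_F^{e(μ)}`** in `ℕ`, `q_F = Nat.sqrt q`, `e(μ) = 2∑_{i<j,i<j'}(μ_i-μ_j)⁺ + ∑_{i<i'}(μ_i-μ_{i'})⁺`
(g47-#2 with `q = q_F²`). [cite: Laumon1995, (4.1.4)] [cite: CartierCorvallis1979, §IV (4.2)] [cite: Minguez2011, §4] -/
theorem relIndex_conjAct_borelInt_eq_sqrt_pow_unitary (hd : UnramifiedLocalConjDatum σ ϖ) (hσ : ∃ x : K, σ x ≠ x)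
    [Finite 𝓀[K]] {μ : Fin N → ℤ} (hμ : ∀ i, μ (Fin.rev i) = -μ i) :
    (toConjAct (⟨zpowDiagGL (uniformizer_ne_zero hd.vϖ) μ, zpowDiagGL_mem_unitaryGroupOfForm hd.σϖ _ hμ⟩ :
          unitaryGroupOfForm σ ((StdForm.antidiagonal N).over K)) •
        (hd.borelLatticeU ⊓ unitaryInt σ ((StdForm.antidiagonal N).over K))).relIndex
        (hd.borelLatticeU ⊓ unitaryInt σ ((StdForm.antidiagonal N).over K)) =
      Nat.sqrt (Nat.card 𝓀[K]) ^
        (2 * (∑ p ∈ (Finset.univ : Finset (Fin N × Fin N)) with (p.1 < p.2 ∧ p.1 < Fin.rev p.2), (μ p.1 - μ p.2).toNat) +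
          ∑ p ∈ (Finset.univ : Finset (Fin N × Fin N)) with (p.1 < p.2 ∧ p.2 = Fin.rev p.1), (μ p.1 - μ p.2).toNat) := by
  rw [hd.relIndex_conjAct_borelInt_eq_unitary hσ hμ, pow_add, pow_mul, sq, hd.sqrt_card_residueField_mul_self hσ]

/-- **`[t_μK_Pt_μ⁻¹ : K_P ∩ t_μK_Pt_μ⁻¹] = q_F^{e'(μ)}`** in `ℕ`, `e'(μ) = 2∑_{i<j,i<j'}(μ_j-μ_i)⁺ + ∑_{i<i'}(μ_{i'}-μ_i)⁺`
(g47-#3). [cite: Laumon1995, (4.1.4)] [cite: CartierCorvallis1979, §IV (4.2)] [cite: Minguez2011, §4] -/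
theorem relIndex_borelInt_conjAct_eq_sqrt_pow_unitary (hd : UnramifiedLocalConjDatum σ ϖ) (hσ : ∃ x : K, σ x ≠ x)
    [Finite 𝓀[K]] {μ : Fin N → ℤ} (hμ : ∀ i, μ (Fin.rev i) = -μ i) :
    (hd.borelLatticeU ⊓ unitaryInt σ ((StdForm.antidiagonal N).over K)).relIndex
        (toConjAct (⟨zpowDiagGL (uniformizer_ne_zero hd.vϖ) μ, zpowDiagGL_mem_unitaryGroupOfForm hd.σϖ _ hμ⟩ :
            unitaryGroupOfForm σ ((StdForm.antidiagonal N).over K)) •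
          (hd.borelLatticeU ⊓ unitaryInt σ ((StdForm.antidiagonal N).over K))) =
      Nat.sqrt (Nat.card 𝓀[K]) ^
        (2 * (∑ p ∈ (Finset.univ : Finset (Fin N × Fin N)) with (p.1 < p.2 ∧ p.1 < Fin.rev p.2), (μ p.2 - μ p.1).toNat) +
          ∑ p ∈ (Finset.univ : Finset (Fin N × Fin N)) with (p.1 < p.2 ∧ p.2 = Fin.rev p.1), (μ p.2 - μ p.1).toNat) := by
  rw [hd.relIndex_borelInt_conjAct_eq_unitary hσ hμ, pow_add, pow_mul, sq, hd.sqrt_card_residueField_mul_self hσ]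

/-! ## §2 The counting duality with `q` explicit -/

/-- **COUNTING DUALITY WITH `q` EXPLICIT, FOR EVERY `N`**: for every `g ∈ U(σ, J₀)` and every antisymmetric `μ`,
`#{γ ∈ K₀gK₀/K₀ : a(γ) = μ} · q_F^{(-∑_{i<j}(μ_i-μ_j))⁺} = #{γ ∈ K₀gK₀/K₀ : a(γ) = -μ} · q_F^{(∑_{i<j}(μ_i-μ_j))⁺}`
(`q_F = √q`; `∑_{i<j}(μ_i-μ_j) = 2⟨ν,μ⟩ = ⟨2ρ, μ⟩`): the number of left cosets with a given Iwasawa exponent and with the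
opposite one differ exactly by the modulus. [cite: CartierCorvallis1979, §IV (4.2), Thm. 4.1] [cite: Macdonald1995, Ch. V (2.6)–(2.7)]
[cite: Laumon1995, (4.1.4)–(4.1.6)] -/
theorem card_filter_iwasawaExp_mul_sqrt_pow_eq_unitary
    [IsHeckeTriple (⊤ : Submonoid (unitaryGroupOfForm σ ((StdForm.antidiagonal N).over K)))
      (unitaryInt σ ((StdForm.antidiagonal N).over K)) (unitaryInt σ ((StdForm.antidiagonal N).over K))]
    (hd : UnramifiedLocalConjDatum σ ϖ) (hσ : ∃ x : K, σ x ≠ x) [Finite 𝓀[K]]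
    (g : unitaryGroupOfForm σ ((StdForm.antidiagonal N).over K)) {μ : Fin N → ℤ} (hμ : ∀ i, μ (Fin.rev i) = -μ i)
    [DecidablePred fun α : unitaryGroupOfForm σ ((StdForm.antidiagonal N).over K) ⧸ unitaryInt σ ((StdForm.antidiagonal N).over K) =>
      hd.iwasawaExp α.out = μ]
    [DecidablePred fun α : unitaryGroupOfForm σ ((StdForm.antidiagonal N).over K) ⧸ unitaryInt σ ((StdForm.antidiagonal N).over K) =>
      hd.iwasawaExp α.out = -μ] :
    ((finite_orbit_quotient (unitaryInt σ ((StdForm.antidiagonal N).over K)) g).toFinset.filter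
          (fun α => hd.iwasawaExp α.out = μ)).card *
        Nat.sqrt (Nat.card 𝓀[K]) ^ (-∑ p ∈ (Finset.univ : Finset (Fin N × Fin N)) with p.1 < p.2, (μ p.1 - μ p.2)).toNat =
      ((finite_orbit_quotient (unitaryInt σ ((StdForm.antidiagonal N).over K)) g).toFinset.filter
          (fun α => hd.iwasawaExp α.out = -μ)).card *
        Nat.sqrt (Nat.card 𝓀[K]) ^ (∑ p ∈ (Finset.univ : Finset (Fin N × Fin N)) with p.1 < p.2, (μ p.1 - μ p.2)).toNat := by
  have key := hd.card_filter_iwasawaExp_mul_relIndex_eq_unitary g hμ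
  rw [hd.relIndex_borelInt_conjAct_eq_sqrt_pow_unitary hσ hμ, hd.relIndex_conjAct_borelInt_eq_sqrt_pow_unitary hσ hμ] at key
  -- the exponents `e = m + S⁺`, `e' = m + (-S)⁺`
  have hS := modulusExp_sub_modulusExp_neg hμ
  rw [← sum_filter_lt_sub_eq_two_mul_satakeTwistExp μ hμ] at hS
  set e := 2 * (∑ p ∈ (Finset.univ : Finset (Fin N × Fin N)) with (p.1 < p.2 ∧ p.1 < Fin.rev p.2), (μ p.1 - μ p.2).toNat) +
    ∑ p ∈ (Finset.univ : Finset (Fin N × Fin N)) with (p.1 < p.2 ∧ p.2 = Fin.rev p.1), (μ p.1 - μ p.2).toNat with he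
  set e' := 2 * (∑ p ∈ (Finset.univ : Finset (Fin N × Fin N)) with (p.1 < p.2 ∧ p.1 < Fin.rev p.2), (μ p.2 - μ p.1).toNat) +
    ∑ p ∈ (Finset.univ : Finset (Fin N × Fin N)) with (p.1 < p.2 ∧ p.2 = Fin.rev p.1), (μ p.2 - μ p.1).toNat with he'
  set S := ∑ p ∈ (Finset.univ : Finset (Fin N × Fin N)) with p.1 < p.2, (μ p.1 - μ p.2) with hSdef
  obtain ⟨m, hme, hme'⟩ : ∃ m : ℕ, e = m + S.toNat ∧ e' = m + (-S).toNat := ⟨e - S.toNat, by omega, by omega⟩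
  have hpos : 0 < Nat.sqrt (Nat.card 𝓀[K]) ^ m := pow_pos (hd.sqrt_card_residueField_pos hσ) m
  rw [hme, hme', pow_add, pow_add, ← mul_assoc, ← mul_assoc, mul_comm _ (Nat.sqrt (Nat.card 𝓀[K]) ^ m),
    mul_comm _ (Nat.sqrt (Nat.card 𝓀[K]) ^ m), mul_assoc, mul_assoc] at key
  exact Nat.eq_of_mul_eq_mul_left hpos key

/-! ## §3 The `w₀`-symmetry over any commutative ring with `q_F` a unit -/

variable {R : Type*} [CommRing R]

omit [Valued K ℤᵐ⁰] in
/-- **A weight `w(e) = u^{-⟨ν, e⟩}` exists** for every unit `u` (`⟨ν, ·⟩ = satakeTwistExp` is additive).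
[cite: CartierCorvallis1979, §IV (4.2)] -/
theorem exists_weight_units_zpow_neg_satakeTwistExp (u : Rˣ) :
    ∃ w : Multiplicative (Fin N → ℤ) →* R, ∀ e : Fin N → ℤ, w (Multiplicative.ofAdd e) = ((u ^ (-satakeTwistExp e) : Rˣ) : R) := by
  obtain ⟨w, hw⟩ := exists_monoidHom_apply_ofAdd_eq_units_zpow (Λ := Fin N → ℤ) u
    (-(AddMonoidHom.mk' (fun e : Fin N → ℤ => satakeTwistExp e) satakeTwistExp_add))
  exact ⟨w, fun e => by rw [hw]; rfl⟩

variable [Finite 𝓀[K]]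
  [IsHeckeTriple (⊤ : Submonoid (unitaryGroupOfForm σ ((StdForm.antidiagonal N).over K)))
    (unitaryInt σ ((StdForm.antidiagonal N).over K)) (unitaryInt σ ((StdForm.antidiagonal N).over K))]

/-- **`𝒮_w(T)_{-μ} = 𝒮_w(T)_μ` OVER ANY COMMUTATIVE RING `R`, FOR EVERY `N`**, every `T ∈ ℋ(U(σ, J₀), K₀; R)` and every
`μ`, for the Satake transform with weight `w(e) = u^{-⟨ν, e⟩}`, `u ∈ Rˣ` with `(u : R) = q_F = √q` (`σ ≠ id`): in g44-#3's
duality both indices are powers of `q_F` (§1) and `⟨ν,μ⟩ + e'(μ) = -⟨ν,μ⟩ + e(μ)` (g47-#3), so the common unit cancels;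
off `Λ⁻` both coefficients vanish. [cite: CartierCorvallis1979, §IV (4.2), Thm. 4.1] [cite: Minguez2011, §4]
[cite: Laumon1995, (4.1.4)–(4.1.6)] [cite: Rogawski1990, §4.5 p. 50] -/
theorem coeff_satakeTransform_neg_of_units_unitary (hd : UnramifiedLocalConjDatum σ ϖ) (hσ : ∃ x : K, σ x ≠ x) (u : Rˣ)
    (hu : (u : R) = Nat.sqrt (Nat.card 𝓀[K])) (w : Multiplicative (Fin N → ℤ) →* R)
    (hw : ∀ e : Fin N → ℤ, w (Multiplicative.ofAdd e) = ((u ^ (-satakeTwistExp e) : Rˣ) : R))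
    (T : heckeAlgebra R (unitaryGroupOfForm σ ((StdForm.antidiagonal N).over K)) (unitaryInt σ ((StdForm.antidiagonal N).over K)))
    (μ : Fin N → ℤ) :
    ((hd.isIwasawaExponent (N := N)).satakeTransform w T).coeff (-μ) =
      ((hd.isIwasawaExponent (N := N)).satakeTransform w T).coeff μ := by
  by_cases hμ : ∀ i, μ (Fin.rev i) = -μ i
  · have key := hd.coeff_satakeTransform_mul_relIndex_eq_unitary (R := R) w T hμ
    have hS := modulusExp_sub_modulusExp_neg hμ
    rw [hd.relIndex_borelInt_conjAct_eq_sqrt_pow_unitary hσ hμ, hd.relIndex_conjAct_borelInt_eq_sqrt_pow_unitary hσ hμ, hw, hw,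
      satakeTwistExp_neg, neg_neg, Nat.cast_pow, Nat.cast_pow, ← hu, mul_assoc, mul_assoc,
      units_zpow_mul_pow_eq u (by omega :
        satakeTwistExp μ +
          ((2 * (∑ p ∈ (Finset.univ : Finset (Fin N × Fin N)) with (p.1 < p.2 ∧ p.1 < Fin.rev p.2), (μ p.2 - μ p.1).toNat) +
            ∑ p ∈ (Finset.univ : Finset (Fin N × Fin N)) with (p.1 < p.2 ∧ p.2 = Fin.rev p.1), (μ p.2 - μ p.1).toNat : ℕ) : ℤ) =
        -satakeTwistExp μ +
          ((2 * (∑ p ∈ (Finset.univ : Finset (Fin N × Fin N)) with (p.1 < p.2 ∧ p.1 < Fin.rev p.2), (μ p.1 - μ p.2).toNat) +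
            ∑ p ∈ (Finset.univ : Finset (Fin N × Fin N)) with (p.1 < p.2 ∧ p.2 = Fin.rev p.1), (μ p.1 - μ p.2).toNat : ℕ) : ℤ))]
      at key
    exact ((IsUnit.mul_left_inj ((Units.isUnit _).mul ((Units.isUnit u).pow _))).1 key).symm
  · have hμ' : ¬ ∀ i, (-μ) (Fin.rev i) = -(-μ) i := fun h => hμ fun i => by
      have := h i; rw [Pi.neg_apply, Pi.neg_apply] at this; omega
    rw [hd.coeff_satakeTransform_eq_zero_of_not_rev _ T hμ, hd.coeff_satakeTransform_eq_zero_of_not_rev _ T hμ']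

/-- **`ι(𝒮_w T) = 𝒮_w T`** over `R` for every `N` (`ι(x^μ) = x^{-μ}`; weight `u^{-⟨ν,·⟩}`, `(u : R) = q_F`).
[cite: CartierCorvallis1979, §IV Thm. 4.1] [cite: Minguez2011, §4] -/
theorem domCongr_neg_satakeTransform_of_units_unitary (hd : UnramifiedLocalConjDatum σ ϖ) (hσ : ∃ x : K, σ x ≠ x) (u : Rˣ)
    (hu : (u : R) = Nat.sqrt (Nat.card 𝓀[K])) (w : Multiplicative (Fin N → ℤ) →* R)
    (hw : ∀ e : Fin N → ℤ, w (Multiplicative.ofAdd e) = ((u ^ (-satakeTwistExp e) : Rˣ) : R))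
    (T : heckeAlgebra R (unitaryGroupOfForm σ ((StdForm.antidiagonal N).over K)) (unitaryInt σ ((StdForm.antidiagonal N).over K))) :
    AddMonoidAlgebra.domCongr R R (AddEquiv.neg (Fin N → ℤ)) ((hd.isIwasawaExponent (N := N)).satakeTransform w T) =
      (hd.isIwasawaExponent (N := N)).satakeTransform w T := by
  refine AddMonoidAlgebra.ext (Finsupp.ext fun μ => ?_)
  rw [IsIwasawaExponent.coeff_domCongr_neg, hd.coeff_satakeTransform_neg_of_units_unitary hσ u hu w hw]

/-- **`range 𝒮_w ⊆ R[Λ⁻]^{w₀}`** over `R` for every `N`: every transform vanishes off `Λ⁻` and is even under `μ ↦ -μ`.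
[cite: CartierCorvallis1979, §IV Thm. 4.1] [cite: Minguez2011, §4] -/
theorem satakeTransform_mem_setOf_of_units_unitary (hd : UnramifiedLocalConjDatum σ ϖ) (hσ : ∃ x : K, σ x ≠ x) (u : Rˣ)
    (hu : (u : R) = Nat.sqrt (Nat.card 𝓀[K])) (w : Multiplicative (Fin N → ℤ) →* R)
    (hw : ∀ e : Fin N → ℤ, w (Multiplicative.ofAdd e) = ((u ^ (-satakeTwistExp e) : Rˣ) : R))
    (T : heckeAlgebra R (unitaryGroupOfForm σ ((StdForm.antidiagonal N).over K)) (unitaryInt σ ((StdForm.antidiagonal N).over K))) :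
    (hd.isIwasawaExponent (N := N)).satakeTransform w T ∈
      {f : AddMonoidAlgebra R (Fin N → ℤ) | (∀ μ : Fin N → ℤ, (¬ ∀ i, μ (Fin.rev i) = -μ i) → f.coeff μ = 0) ∧
        ∀ μ : Fin N → ℤ, f.coeff (-μ) = f.coeff μ} :=
  ⟨fun _ hμ => hd.coeff_satakeTransform_eq_zero_of_not_rev _ T hμ,
    fun μ => hd.coeff_satakeTransform_neg_of_units_unitary hσ u hu w hw T μ⟩

end UnramifiedLocalConjDatum

end Literature.NumberTheory.Automorphic.HermitianLattice
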